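import Summits.CriticalPhenomena.CardyFormulaZ2.Theses.CardyBoundaryCoulombGas
import Summits.CriticalPhenomena.CardyFormulaZ2.Theorems.CardyBoundaryCoulombGasBoundaryDefectGaussianRStubTransferV2
import Summits.CriticalPhenomena.CardyFormulaZ2.Theorems.CardyBoundaryCoulombGasBoundaryDefectGaussianRStubRigidityOfLocalLawsPart9
import Summits.CriticalPhenomena.CardyFormulaZ2.Theorems.CardyBoundaryCoulombGasBoundaryDefectGaussianRStubTransportPaths
import Summits.CriticalPhenomena.CardyFormulaZ2.Theorems.CardyBoundaryCoulombGasBoundaryDefectGaussianRStubHoleFree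
import Summits.CriticalPhenomena.CardyFormulaZ2.Theorems.CardyBoundaryCoulombGasBoundaryDefectGaussianRStubGreenKernelAsymptoticsPart5
import Summits.CriticalPhenomena.CardyFormulaZ2.Theorems.CardyBoundaryCoulombGasBoundaryDefectGaussianRStubReferenceLimitPart7
import Summits.CriticalPhenomena.CardyFormulaZ2.Theorems.CardyBoundaryCoulombGasBoundaryDefectGaussianRStubDictionaryPositivity
import Summits.CriticalPhenomena.CardyFormulaZ2.Theorems.CardyBoundaryCoulombGasBoundaryDefectGaussianRStubRigidityOfLocalLawsPart11
import Summits.CriticalPhenomena.CardyFormulaZ2.Theorems.CardyBoundaryCoulombGasBoundaryDefectGaussianRStubClusterLocalityV3Glue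
import Literature.Probability.LatticeModels.FlatBoundaryPoissonKernelLimit
import Literature.Probability.LatticeModels.FlatBoundaryPoissonKernelLimitProofs
import Literature.Probability.LatticeModels.BoundaryNormalisedPoissonKernelLimitProofs
import Literature.Probability.LatticeModels.CollarLegModelRainbow
import Literature.Probability.LatticeModels.DirichletGreenFunction

/-!
# Line `rainbow-monomials-in-excursion-kernels` — skeleton **v7** for crux `BoundaryDefectGaussianR`
# (stmt-CriticalPhenomena-14132, route `CardyBoundaryCoulombGas`, sub-problem `CardyFormulaZ2`)

Lead `prover-line-stmt-CriticalPhenomena-14132-c1-0` (continuation of lead `…-14132-0`), 2026-08-16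
(v1 = crux-plan seat `planner-cruxplan-stmt-CriticalPhenomena-14132-rainbow-monomials-in-0`; idea card
`Cruxes/BoundaryDefectGaussianR/Ideas/rainbow-monomials-in-excursion-kernels.md`; line card `Lines/….md`).

## What changed in v7 (continuation seat c3, 2026-08-17 00:10Z) — CLUSTER LOCALITY RE-TYPED WITH CHARTS AND SPLIT; (2;2) MEMBER PROVED

* RESHAPE of Stub 2′: the registered `stub_clusterLocalityV2` quantified over general hole-free `V, V'`, but the insertion dictionary behind it
  needs LOCAL CHARTS (PINCH / FJORD / NECK counterexamples, Parts 34/46). It is replaced by CLV3 = the same law for CHART-REGULAR `V, V'`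
  (`Literature.Probability.LatticeModels.CollarLegModel.ChartRegular`, new Literature file `CollarLegModelCharts.lean`, p131200) and CLV3 is
  DERIVED (`stub_clusterLocalityV3`, glue `clusterLocalityV3_of_rainbowLocality`, …StubClusterLocalityV3Glue, p131700) from the landed Green locality G1
  and ONE new stub `stub_rainbowLocality` (RAINBOW LOCALITY = the percolation half P1 for general leg families, typed on the rainbow functional
  `log(‖Zins‖/‖Z‖)` itself; through the landed dictionary it is the locality of the rainbow count `#{ω ⊆ E_V : Rainbow}/2^{|E_V|}`). The rigidity glue is
  re-instantiated: `s3_rigidityOfTransportV3 : TRANSPORT → REG → REAL → PT → CLV3 → RIGIDITY` with `s3_eventuallyRegular` (REG: lattice approximations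
  are eventually chart-regular with king-connected complement; …StubRigidityOfLocalLawsPart11, p131370).
* The (2;2) member of `stub_rainbowLocality` is a THEOREM: `s18_rainbowLocality_22` (…S18Rainbow22Part1–4, p132784; rainbow event of the (2;2) datum =
  two-point connection `s18_rainbow22_iff_conn` p132349, counting bridge p132325, and the landed `s12_twoPointLocality`).
* Further members (wave 3 of seat c3): (1;1) — `s18_rainbowLocality_11` (…S18Rainbow11, p133158: every ω is rainbow, the functional is ≡ 1); (1,1;2) — the
  rainbow event is "the sink is joined to the wired arc" (`s18_rainbow112_iff_conn`, …S18Rainbow112Part1–3, p134162; its locality = point-to-arc separation, open).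
* THREE `sorry`s remain, all percolation-theoretic and crux-sized or research-level: `stub_pointTransport` (amplitude / ratio-limit law),
  `stub_canonicalLimit` (sharp normalisation for one explicit family), `stub_rainbowLocality` (half-plane multi-arm separation for general leg families;
  (2;2) and (1;1) done). Seat c3 outcome: PROMOTE `stub_pointTransport` (with `stub_canonicalLimit`): everything formalizable in this line is landed.

## What changed in v6 (continuation seat c3, 2026-08-16 23:30Z) — THE INSERTION DICTIONARY D2 IS A THEOREM

* `stub_rainbowNonempty` and `stub_dictionaryPositivity` are no longer stubs: both are PROVED in
  `…Theorems/CardyBoundaryCoulombGasBoundaryDefectGaussianRStubDictionaryPositivity.lean` (p131113; imported), hence `stub_realisability`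
  (REAL) is an unconditional theorem of this file. Behind them, seat c3's wave 1 landed the whole D2 completion skeleton of seat c2
  (`Lines/rainbow_monomials_D2_skeleton.lean`): `s17_eventually_configsNonempty` (…S17ConfigsNonemptyPart1–14, p130998: a capped
  multi-source distance transform is a valid height configuration of the jump collar, eventually), `s17_heightsExist` (…S17HeightsExistPart1–5,
  p129797: turning-rule-invariant arrow assignments with the forced cut values are realised by valid heights — divergence-free dart windings),
  `s17_strandTurning` (…S17StrandTurningPart1–6, p129560: the turning number of a strand between two ends is configuration-independent —
  closed trails of the oriented medial graph + the combinatorial Umlaufsatz with winding sign), `s17_dictionary_of` (…S17DictionaryOfPart1–3,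
  p129231: the Baxter–Kelland–Wu count assembly), `s17_rainbow_of_config` (p128024), `s17_forcedBits` (p128253), `s17_eventually_regular`
  (p128090), `s17_uncutLoopTurning` (p127263), `s17_norm_Zins_pos_of_dictionary` (p127277), and the glue `s17_dictionary`
  (**‖Zins V ι‖ = #{ω ⊆ E : Rainbow ι V ω}** for admissible flat charted data), `s17_rainbowNonempty_of`, `s17_dictionaryPositivity_of`.
* THREE `sorry`s remain, all percolation-theoretic: `stub_pointTransport` (ratio-limit / amplitude law; crux-sized, PT-ANALYSIS.md),
  `stub_canonicalLimit` (sharp normalisation for one explicit family; crux-sized) and `stub_clusterLocalityV2` (Green locality G1 LANDED,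
  dictionary D2 LANDED; open content = percolation locality P1 for general leg families; NOTE the registered text quantifies over general
  hole-free `V, V'` while the dictionary needs CHART(3)/KINGCHART(6) — re-typing with charts = `s3_rigidityAbstractV2` re-instantiated with
  `C1 W := lattice-connected W ∧ CHART3 W ∧ KINGCHART6 W`, supplied eventually by `stub_holeFree` + `s16_eventually_chart/kingChart`).

## What changed in v5 (continuation seat c1, wave-1 integration)

* RESHAPE of Stub 4′: `stub_referenceLimitV2` (REFV2) is no longer a stub — it is DERIVED in this file from RIGIDITY and the
  new, strictly smaller stub `stub_canonicalLimit` (CANON: convergence of ONE explicit sequence family — the reference square's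
  lattice boxes with the canonical bottom-row configuration) by the landed glue `refV2_of_canonicalLimit`
  (…StubReferenceLimitPart7, p118202; explicit square + canonical configurations `s12_canonicalConfiguration`, Part6, p117657).
* RESHAPE of Stub 3c: `stub_realisability` (REAL) is DERIVED from two new stubs on the same eventual filter:
  `stub_rainbowNonempty` (an explicit rainbow configuration exists; L) and `stub_dictionaryPositivity` (= the insertion dictionary D2
  in the strength REAL needs: a rainbow configuration ⇒ 0 < ‖Zins‖/‖Z‖; XL, layers 0–2 of its proof LANDED this seat).
  Stubs now: `stub_pointTransport` (lead), `stub_clusterLocalityV2`, `stub_rainbowNonempty`, `stub_dictionaryPositivity`,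
  `stub_canonicalLimit` — five sorries; REAL and REFV2 are glue theorems of this file.

## Waves 2–4 of seat c1 (all ACCEPTED, 2026-08-16 17:55–20:20Z) — state of the D2 programme behind `stub_dictionaryPositivity`

Hypotheses (eventually true for the lattice approximations `V_n`; FALSE for general hole-free `V` — counterexamples PINCH / FJORD /
WIDTH-1-NECK in the docstrings of …StubRealisabilityPart34 / Part46): FLAT (insertion points flat at lattice radius `sinkLegs + 4`), CHART
(boundary-vertex half-plane/convex/reflex charts of radius 3), NoPinch, king charts — ALL PROVED EVENTUALLY for `V_n`:
`s16_eventually_chart/kingChart/noPinch/flat/flat4` (Parts 47/48, p122049/p124672). Landed under them: Lemma C `s13_frozenConsistency`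
(Part13 p119127) + `s13_openEdgeLevels` (Parts 31–34, p121034: frozen open edges are never cuts); Lemma V `s13_unitDifferences_tracked`
(Parts 41–46, p123834: unit height differences at every tracked corner); per-configuration rewrite `s13_perConfigurationFactor` (Part14
p119057: ∏ turnFactor = indicator × ∏ e^{iε(bit)g}); strand ends `s14_strandEnds_tags/_pairs/_start/_types` (Parts 20–23, 26, 27: each tag
−L..−1 exactly twice, level pairs (m,m+1), E2, E3); level pairs along strands (Part17 p118980); rainbow forcing `s14_rainbow_of_valid`
(Part18 p119501), frozen transfer (Part19 p119696), `s14_trackedCuts_are_ends` (Parts 35–38, p122926) ⇒ `tc_rainbow_of_consistent`: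
**A(ω) ≠ 0 ⇒ Rainbow ω is COMPLETE** (needs only live consistency + validity + FLAT + CHART); cell-region rim `s15_cellRegion_rim`
(Parts 24/25/30, p121047: pinch-free, edge-connected, co-hole-free ⇒ one simple traced rim polygon). Literature: `CollarLegModelStrands`
(p118000), `…Expansion` (p118380: weight = Σ_ω ∏ turnFactor), `…Consistency` (p118434), `…Rainbow` (p118572: IsCut/Joined/strandEnds/Rainbow),
`…CellRegion` (p118919), `MedialPolygonWinding` (p118767). REMAINING for `stub_dictionaryPositivity`: EXISTENCE of heights for a rainbow ω
(rim-closure winding formula, T5c), strand PHASES (perturbed-polygon Hopf, T6), the count ASSEMBLY via `s12_bkwStrandExpansion`; for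
`stub_rainbowNonempty`: an explicit configuration; for `stub_clusterLocalityV2`: re-typing with CHART (v6) + general-family P1.

## What changed in v4 (continuation seat c1, 2026-08-16 17:00Z; wave-1 results appended 18:1xZ)

* Stubs 5a/5b are DISCHARGED: the two named Literature facts the Green-kernel asymptotics were reduced to
  are now theorems of the tree — `Kenyon2000_flatEdgePoissonKernelLimit_holds`
  (`Literature/Probability/LatticeModels/FlatBoundaryPoissonKernelLimitProofs.lean`) and
  `ChelkakSmirnov2011_boundaryNormalisedPoissonKernelLimit_holds`
  (`Literature/Probability/LatticeModels/BoundaryNormalisedPoissonKernelLimitProofs.lean`); the skeleton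
  imports them, so GREEN (`greenKernelAsymptotics_of_facts …`) is unconditional. Four `sorry`s remain:
  `stub_pointTransport` (lead), `stub_clusterLocalityV2`, `stub_realisability`, `stub_referenceLimitV2`.
* Wave 1 of this seat (all ACCEPTED): P1 for (2;2) COMPLETE — `s12_twoArmBound` (…StubClusterLocalityV2Part10, p117527)
  and `s12_twoPointLocality` (…Part11, p118102: half-plane locality of P_{1/2}[u ↔ w in V], unconditional RSW technology);
  D2 (insertion dictionary) programme: definition layer `Literature/Probability/LatticeModels/CollarLegModelStrands.lean`
  (p118000: tracked corners, completed configuration, turn factors, six-vertex split proved), abstract strand expansion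
  `s12_bkwStrandExpansion` (…StubRealisabilityPart5, p117522), collar semantics `s12_collarArc/Pockets/FaceH/VertH/Levels`
  (…Part7/8, p117459/p117685), heights-from-arrows `s13_heightsFromArrows` (…Part10, p117624); layer 1 (BKW factorisation
  of the weight over bond configurations) proved, queued behind the farm build; REFV2 reduced to ONE canonical limit:
  `s12_canonicalConfiguration` (…StubReferenceLimitPart6, p117657) + `refV2_of_canonicalLimit` (Part7, in flight).
* Lead analysis (evidence PT-ANALYSIS.md): `stub_pointTransport` and the LIMIT conjunct of `stub_referenceLimitV2` are
  crux-sized (each implies the half-plane one-arm exponent 1/3 for bond percolation on ℤ², the open crux HalfPlaneOneArmThird).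

## The line in one paragraph (unchanged)

Write `P_V(p) := ‖Zins V ι(p)‖ / ‖Z V‖` for the rainbow probability of the leg family `(L, sink j)`
inserted at the boundary lattice points `p : Fin k → ℤ²` of a lattice domain `V`, `e_i := L_i`
(sources), `e_j := 1 - L_j` (sink), and let `G_V` be the Dirichlet Green function of simple random
walk killed on leaving `V` (tree: `dirichletGreen`). The GREEN MONOMIAL of the configuration is
`Λ_V(p) := Σ_{i<i'} (−e_i e_i'/6) · log G_V(p_i, p_i')` and the line's one functional is
`F_V(p) := log P_V(p) − Λ_V(p)`; the Green-monomial law (GM) `F → log C′` plus the flat-edge asymptotics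
of `G_V` IS the crux (`stub_transferV2`, LANDED), and (GM) splits map-free into RIGIDITY + REFERENCE LIMIT,
with rigidity reduced to local lattice laws (`s3_rigidityOfTransportV2`, LANDED).

## What changed in v2 (wave-1 verdicts, all evidence in the lead folder `work/stubs/*.md`)

* `stub_transfer` LANDED (…Theorems/…StubTransfer.lean, p93038; flat-mark conformal geometry Parts 3–5, limit
  algebra Part 1) and re-landed as `stub_transferV2 : RIGIDITY → REFV2 → GREEN → crux` (p93898) after
* `stub_referenceLimit` was found FALSE for degenerate families (`k = 1`, or `L i = 0`): corrected `REFV2`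
  (Stub 4′ below); its non-vacuity half is LANDED (`referenceDomain_approximable`, p90801).
* `stub_rigidity_of_local_laws` was MISSTATED (the two local laws presuppose `P > 0`; transport paths are a
  separate geometric statement): landed as `s3_rigidityOfTransport : TRANSPORT → REAL → PT → CL → RIGIDITY`
  (p92766, walk combinatorics Parts 5–7) and, after
* `stub_clusterLocality` was REFUTED as registered (far hole / far diagonal component; corrected `CLV2` with
  hole-free hypotheses, Stub 2′), re-landed as
  `s3_rigidityOfTransportV2 : TRANSPORT → HOLEFREE → REAL → PT → CLV2 → RIGIDITY` (p94720).
* `stub_greenKernelAsymptotics`: statement audited TRUE (c = 1/π); blocked on the classical named fact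
  (Chelkak–Smirnov 2011 Thm 3.13 ⊗ Kenyon 2000 Cor. 19); Green-function lemmas landed (Parts 1–3).
* New stubs (typed by the workers, registered untruncated with `stub-add`): `stub_transportPaths : TRANSPORT`,
  `stub_holeFree : HOLEFREE`, `stub_realisability : REAL`. Seven sorried stubs in all (stubs_max).

## What changed in v3 (wave-2 results, 2026-08-16 09:45–16:40Z)

* `stub_transportPaths` LANDED (…StubTransportPaths.lean p115765 + Parts 1–33: local structure of rectilinear
  Jordan frontiers, corner charts, order of the marks along the walk, route execution).
* `stub_holeFree` LANDED (…StubHoleFree.lean p96228 + Part1: grid method + the tree's Jordan curve theorem).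
* `stub_greenKernelAsymptotics` is CLOSED MODULO TWO NAMED LITERATURE FACTS: `greenKernelAsymptotics_of_facts :
  Kenyon2000_flatEdgePoissonKernelLimit → ChelkakSmirnov2011_boundaryNormalisedPoissonKernelLimit → GREEN`
  (…StubGreenKernelAsymptoticsPart5 p96030; facts relocated to
  `Literature/Probability/LatticeModels/FlatBoundaryPoissonKernelLimit.lean` p96029); the two facts are now the
  stubs `stub_flatEdgePoissonKernelLimit`, `stub_boundaryNormalisedPoissonKernelLimit` (discharging = proving
  Kenyon 2000 Cor. 19 / Chelkak–Smirnov 2011 Thm 3.13 on ℤ²).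
* D1 `Z(ofDomain V) = 2^{|E|}` for every finite `V` with king-connected complement LANDED (…StubRealisabilityPart1–4,
  `Z_ofDomain_eq_two_pow`, `norm_Z_ofDomain_pos`: heights ↔ arrows weight matching + BKW orientation expansion);
  `stub_realisability` remains = the insertion dictionary D2.
* G1 (Green locality) LANDED in full (…StubClusterLocalityV2Part1–9, `green_locality`, `s10_greenLocalityZ2`);
  `stub_clusterLocalityV2` remains = D2 + percolation locality P1 (`PercolationLocality22` typed, first step landed).

## Stubs (v3: six `sorry`s; v4: four — 5a/5b discharged)

* `stub_pointTransport`        — unchanged (the lever; XL, open: sharp local covariance / ratio-limit law). Lead.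
* `stub_clusterLocalityV2`     — CL + hole-free/connected hypotheses. [L–XL: G1 provable, P1 + dictionary D2]
* `stub_transportPaths`        — TRANSPORT. LANDED (imported).
* `stub_holeFree`              — HOLEFREE. LANDED (imported).
* `stub_realisability`         — REAL. DERIVED in v5 from `stub_rainbowNonempty` (L) and `stub_dictionaryPositivity` (XL = D2).
* `stub_referenceLimitV2`      — REFV2. DERIVED in v5 from RIGIDITY + `stub_canonicalLimit` (glue landed p118202).
* `stub_canonicalLimit`        — CANON (v5). [XL, open: the sharp normalisation for ONE explicit sequence family]
* `stub_flatEdgePoissonKernelLimit`, `stub_boundaryNormalisedPoissonKernelLimit` — the two named Literature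
  facts GREEN is reduced to (reduction landed). DISCHARGED in v4 (`…_holds`, Literature proofs files).
* `BoundaryDefectGaussianR_of` — `stub_transferV2 RIG stub_referenceLimitV2 GREEN` with `RIG := s3_rigidityOfTransportV2
  stub_transportPaths stub_holeFree stub_realisability stub_pointTransport stub_clusterLocalityV2`, `stub_referenceLimitV2 :=
  refV2_of_canonicalLimit RIG stub_canonicalLimit` (v5) and `GREEN := greenKernelAsymptotics_of_facts stub_flatEdgePoissonKernelLimit
  stub_boundaryNormalisedPoissonKernelLimit`, concluding the crux BY NAME; no `sorry` outside the four open stubs.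

## Disproof.lean honoured (cycle 2 v5; no `_false_without_` theorem; §8′ had no targets before this line was picked)

§5 H-onto / H-noncorner / H-realisation and §4 `not_halfPlaneTwoPointLawUniform`: every configuration class below is
`r`-separated and `r`-flat; corners are crossed at scale `ρ`, never occupied; the `(1;1)` unit test reads `e = (1,0)`,
`Λ ≡ 0`. §9's cap `C ≤ cardyConst/3` constrains `e^ℓ` of Stub 4′ for `(1,1,1;3̄)` from above only — consistent. The
landed `Negative/MarkDensity*` lemmas are identities/caps, not `¬`-instances of any stub. Harness note: registered
stub signatures are truncated at 3900 characters; `stub_pointTransport` (≈ 9.8k) can only be landed together with a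
registered short sub-goal in the same file (device used by every wave-1 worker).
-/

noncomputable section

open Filter Topology

namespace Summit.CriticalPhenomena.CardyFormulaZ2.Cruxes.BoundaryDefectGaussianR.RainbowMonomialsInExcursionKernels

/-! ### The exponent bookkeeping of the line (proved) -/

/-- **`Σe = 1` ⟺ no one-body factor.** For a label vector with `Σ_j e_j = 1`, the total exponent the
pair monomial `∏_{j ≠ i} K(x_i,x_j)^{-e_i e_j/6}` assigns to the point `x_i` is the Kac weight
`h(e_i) = e_i (e_i - 1)/6` — the identity that turns `∏ K_Ω^{-e_ie_j/6}` into the crux's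
`∏ |w_i - w_j|^{e_ie_j/3} ∏ |w′_i|^{h(e_i)}` (idea card, `Sketch.kac_from_pairs`). [folklore] -/
theorem kac_from_pairs {k : ℕ} (e : Fin k → ℝ) (hsum : ∑ j, e j = 1) (i : Fin k) :
    ∑ j ∈ Finset.univ.erase i, (-(e i * e j) / 6) = e i * (e i - 1) / 6 := by
  have h1 : ∑ j ∈ Finset.univ.erase i, (-(e i * e j) / 6) = -(e i / 6) * ∑ j ∈ Finset.univ.erase i, e j := by
    rw [Finset.mul_sum]
    refine Finset.sum_congr rfl fun j _ => ?_
    ring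
  rw [h1, Finset.sum_erase_eq_sub (Finset.mem_univ i), hsum]
  ring

/-- The mesh powers cancel: `2 Σ_{i<i'} (-e_i e_i'/6) = Σ_i h(e_i)` when `Σ e = 1` (both equal
`(Σ e² - 1)/6`); this is why the Green-monomial law carries no power of `δ`. Stated over the
ordered-pair sum `Σ_i Σ_{i' ≠ i}` (= twice the sum over `i < i'`). [folklore] -/
theorem mesh_powers_cancel {k : ℕ} (e : Fin k → ℝ) (hsum : ∑ j, e j = 1) :
    ∑ i, ∑ i' ∈ Finset.univ.erase i, (-(e i * e i') / 6) = ∑ i, e i * (e i - 1) / 6 :=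
  Finset.sum_congr rfl fun i _ => kac_from_pairs e hsum i

/-! ### Stub 1 — POINT TRANSPORT (the lever; unchanged) -/

/-- **Stub 1 (lever) — point transport.** For a leg family `(L, sink j)` and a rectilinear
Jordan domain `D` discretised at mesh `δ_n → 0⁺` (`V_n = {v : δ_n v ∈ closure D}`):
(a) UNIT SLIDE — eventually in `n`, uniformly over admissible injective configurations `p` whose points
are `r/δ_n`-flat (the lattice ball of that radius around each point meets `V_n` in a discrete
half-plane) and pairwise `r/δ_n`-separated, sliding ONE point by one lattice step along its edge
(`p′ = update p i (p i + τ)`, still admissible, both rainbow probabilities positive) changes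
`F = log P − Λ` by at most `ε·δ_n`: the discrete logarithmic derivative of the rainbow probability in
each insertion point IS that of the Green monomial, to first order ("amplitude law"; for `(2;2)`:
`P[x+1↔y]/P[x↔y] = (G(x+1,y)/G(x,y))^{1/3} + o(δ)`); (b) `ρ`-JUMP — for some `ρ = ρ(r, ε) ≤ r`,
replacing one point by another admissible `ρ/4·δ_n⁻¹`-flat point within lattice distance `ρ/δ_n`
(the other points `r`-flat, everything `r`-separated) changes `F` by at most `ε`; used only to cross
convex and reflex corners at scale `ρ`. Why plausibly true: (GM) in differential form; (a) is a
first-order local CLT for a translation of one insertion (coupling `x ↔ x+τ` by the local reflection,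
broken only by the global geometry at order `δ`), (b) is macroscopic continuity of `F` across a
corner (Disproof §7(B): the corner-proximity law of the `(2;2)` amplitude is parameter-free and passes
at 0.3 %). Size: XL (open; it carries the conformal-covariance content in Hadamard form). [folklore] -/
theorem stub_pointTransport :
    ∀ (k : ℕ) (L : Fin k → ℕ) (j : Fin k), L j = ∑ i ∈ Finset.univ.erase j, L i → (∀ (D :
    Literature.Probability.RandomPlanarGeometry.JordanDomain), (∃ S : Finset (ℂ × ℂ), (∀ q ∈ S, q.1.re = q.2.re
    ∨ q.1.im = q.2.im) ∧ frontier D.carrier ⊆ ⋃ q ∈ S, segment ℝ q.1 q.2) → ∀ (r ε : ℝ), 0 < r → 0 < ε → ∀ (δ :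
    ℕ → ℝ), (∀ n, 0 < δ n) → Filter.Tendsto δ Filter.atTop (nhds 0) → ∀ (V : ℕ → Finset (ℤ × ℤ)), (∀ n, ∀ v : ℤ
    × ℤ, v ∈ V n ↔ (((v).1 : ℂ) * ((δ n : ℝ) : ℂ) + ((v).2 : ℂ) * ((δ n : ℝ) : ℂ) * Complex.I) ∈ closure
    D.carrier) → ∀ᶠ n in Filter.atTop, ∀ (p : Fin k → ℤ × ℤ) (i : Fin k) (τ : ℤ × ℤ), (τ = (1, 0) ∨ τ = (-1, 0)
    ∨ τ = (0, 1) ∨ τ = (0, -1)) → Function.Injective p → Function.Injective (Function.update p i (p i + τ)) →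
    Literature.Probability.LatticeModels.CollarLegModel.LegInsertionData.IsAdmissible (⟨(Finset.univ.erase
    j).image (p), fun v ↦ ∑ b ∈ (Finset.univ.erase j).filter (fun b ↦ (p) b = v), L b, (p) j⟩ :
    Literature.Probability.LatticeModels.CollarLegModel.LegInsertionData) (V n) →
    Literature.Probability.LatticeModels.CollarLegModel.LegInsertionData.IsAdmissible (⟨(Finset.univ.erase
    j).image ((Function.update p i (p i + τ))), fun v ↦ ∑ b ∈ (Finset.univ.erase j).filter (fun b ↦
    ((Function.update p i (p i + τ))) b = v), L b, ((Function.update p i (p i + τ))) j⟩ :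
    Literature.Probability.LatticeModels.CollarLegModel.LegInsertionData) (V n) → 0 <
    (‖Literature.Probability.LatticeModels.CollarLegModel.Zins (V n) (⟨(Finset.univ.erase j).image (p), fun v ↦
    ∑ b ∈ (Finset.univ.erase j).filter (fun b ↦ (p) b = v), L b, (p) j⟩ :
    Literature.Probability.LatticeModels.CollarLegModel.LegInsertionData)‖ /
    ‖(Literature.Probability.LatticeModels.CollarLegModel.ofDomain (V n)).Z‖) → 0 <
    (‖Literature.Probability.LatticeModels.CollarLegModel.Zins (V n) (⟨(Finset.univ.erase j).image
    ((Function.update p i (p i + τ))), fun v ↦ ∑ b ∈ (Finset.univ.erase j).filter (fun b ↦ ((Function.update p i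
    (p i + τ))) b = v), L b, ((Function.update p i (p i + τ))) j⟩ :
    Literature.Probability.LatticeModels.CollarLegModel.LegInsertionData)‖ /
    ‖(Literature.Probability.LatticeModels.CollarLegModel.ofDomain (V n)).Z‖) → (∀ i', (∃ d : ℤ × ℤ, (d = (1, 0)
    ∨ d = (-1, 0) ∨ d = (0, 1) ∨ d = (0, -1)) ∧ ∀ v : ℤ × ℤ, (((((v).1 - (p i').1) ^ 2 + ((v).2 - (p i').2) ^ 2
    : ℤ) : ℝ)) ≤ (r / δ n) ^ 2 → (v ∈ V n ↔ 0 ≤ (v.1 - (p i').1) * d.1 + (v.2 - (p i').2) * d.2))) → (∀ i₁ i₂ :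
    Fin k, i₁ ≠ i₂ → (r / δ n) ^ 2 ≤ ((((((p) i₁).1 - ((p) i₂).1) ^ 2 + (((p) i₁).2 - ((p) i₂).2) ^ 2 : ℤ) :
    ℝ))) → |(Real.log (‖Literature.Probability.LatticeModels.CollarLegModel.Zins (V n) (⟨(Finset.univ.erase
    j).image ((Function.update p i (p i + τ))), fun v ↦ ∑ b ∈ (Finset.univ.erase j).filter (fun b ↦
    ((Function.update p i (p i + τ))) b = v), L b, ((Function.update p i (p i + τ))) j⟩ :
    Literature.Probability.LatticeModels.CollarLegModel.LegInsertionData)‖ /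
    ‖(Literature.Probability.LatticeModels.CollarLegModel.ofDomain (V n)).Z‖) - (∑ i₁ : Fin k, ∑ i₂ ∈
    Finset.univ.filter (fun i₂ : Fin k ↦ i₁ < i₂), (-((if i₁ = j then (1 - (L j : ℝ)) else (L i₁ : ℝ)) * (if i₂
    = j then (1 - (L j : ℝ)) else (L i₂ : ℝ))) / 6) * Real.log
    (Literature.Probability.LatticeModels.dirichletGreen ((V n).image (fun v : ℤ × ℤ ↦ (![v.1, v.2] : Fin 2 →
    ℤ))) (![(((Function.update p i (p i + τ))) i₁).1, (((Function.update p i (p i + τ))) i₁).2] : Fin 2 → ℤ)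
    (![(((Function.update p i (p i + τ))) i₂).1, (((Function.update p i (p i + τ))) i₂).2] : Fin 2 → ℤ)))) -
    (Real.log (‖Literature.Probability.LatticeModels.CollarLegModel.Zins (V n) (⟨(Finset.univ.erase j).image
    (p), fun v ↦ ∑ b ∈ (Finset.univ.erase j).filter (fun b ↦ (p) b = v), L b, (p) j⟩ :
    Literature.Probability.LatticeModels.CollarLegModel.LegInsertionData)‖ /
    ‖(Literature.Probability.LatticeModels.CollarLegModel.ofDomain (V n)).Z‖) - (∑ i₁ : Fin k, ∑ i₂ ∈
    Finset.univ.filter (fun i₂ : Fin k ↦ i₁ < i₂), (-((if i₁ = j then (1 - (L j : ℝ)) else (L i₁ : ℝ)) * (if i₂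
    = j then (1 - (L j : ℝ)) else (L i₂ : ℝ))) / 6) * Real.log
    (Literature.Probability.LatticeModels.dirichletGreen ((V n).image (fun v : ℤ × ℤ ↦ (![v.1, v.2] : Fin 2 →
    ℤ))) (![((p) i₁).1, ((p) i₁).2] : Fin 2 → ℤ) (![((p) i₂).1, ((p) i₂).2] : Fin 2 → ℤ))))| ≤ ε * δ n) ∧ (∀ (D
    : Literature.Probability.RandomPlanarGeometry.JordanDomain), (∃ S : Finset (ℂ × ℂ), (∀ q ∈ S, q.1.re =
    q.2.re ∨ q.1.im = q.2.im) ∧ frontier D.carrier ⊆ ⋃ q ∈ S, segment ℝ q.1 q.2) → ∀ (r ε : ℝ), 0 < r → 0 < ε →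
    ∃ ρ : ℝ, 0 < ρ ∧ ρ ≤ r ∧ ∀ (δ : ℕ → ℝ), (∀ n, 0 < δ n) → Filter.Tendsto δ Filter.atTop (nhds 0) → ∀ (V : ℕ →
    Finset (ℤ × ℤ)), (∀ n, ∀ v : ℤ × ℤ, v ∈ V n ↔ (((v).1 : ℂ) * ((δ n : ℝ) : ℂ) + ((v).2 : ℂ) * ((δ n : ℝ) : ℂ)
    * Complex.I) ∈ closure D.carrier) → ∀ᶠ n in Filter.atTop, ∀ (p : Fin k → ℤ × ℤ) (i : Fin k) (q : ℤ × ℤ),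
    Function.Injective p → Function.Injective (Function.update p i q) →
    Literature.Probability.LatticeModels.CollarLegModel.LegInsertionData.IsAdmissible (⟨(Finset.univ.erase
    j).image (p), fun v ↦ ∑ b ∈ (Finset.univ.erase j).filter (fun b ↦ (p) b = v), L b, (p) j⟩ :
    Literature.Probability.LatticeModels.CollarLegModel.LegInsertionData) (V n) →
    Literature.Probability.LatticeModels.CollarLegModel.LegInsertionData.IsAdmissible (⟨(Finset.univ.erase
    j).image ((Function.update p i q)), fun v ↦ ∑ b ∈ (Finset.univ.erase j).filter (fun b ↦ ((Function.update p
    i q)) b = v), L b, ((Function.update p i q)) j⟩ :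
    Literature.Probability.LatticeModels.CollarLegModel.LegInsertionData) (V n) → 0 <
    (‖Literature.Probability.LatticeModels.CollarLegModel.Zins (V n) (⟨(Finset.univ.erase j).image (p), fun v ↦
    ∑ b ∈ (Finset.univ.erase j).filter (fun b ↦ (p) b = v), L b, (p) j⟩ :
    Literature.Probability.LatticeModels.CollarLegModel.LegInsertionData)‖ /
    ‖(Literature.Probability.LatticeModels.CollarLegModel.ofDomain (V n)).Z‖) → 0 <
    (‖Literature.Probability.LatticeModels.CollarLegModel.Zins (V n) (⟨(Finset.univ.erase j).image
    ((Function.update p i q)), fun v ↦ ∑ b ∈ (Finset.univ.erase j).filter (fun b ↦ ((Function.update p i q)) b =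
    v), L b, ((Function.update p i q)) j⟩ :
    Literature.Probability.LatticeModels.CollarLegModel.LegInsertionData)‖ /
    ‖(Literature.Probability.LatticeModels.CollarLegModel.ofDomain (V n)).Z‖) → (∀ i', i' ≠ i → (∃ d : ℤ × ℤ, (d
    = (1, 0) ∨ d = (-1, 0) ∨ d = (0, 1) ∨ d = (0, -1)) ∧ ∀ v : ℤ × ℤ, (((((v).1 - (p i').1) ^ 2 + ((v).2 - (p
    i').2) ^ 2 : ℤ) : ℝ)) ≤ (r / δ n) ^ 2 → (v ∈ V n ↔ 0 ≤ (v.1 - (p i').1) * d.1 + (v.2 - (p i').2) * d.2))) →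
    (∃ d : ℤ × ℤ, (d = (1, 0) ∨ d = (-1, 0) ∨ d = (0, 1) ∨ d = (0, -1)) ∧ ∀ v : ℤ × ℤ, (((((v).1 - (p i).1) ^ 2
    + ((v).2 - (p i).2) ^ 2 : ℤ) : ℝ)) ≤ (ρ / 4 / δ n) ^ 2 → (v ∈ V n ↔ 0 ≤ (v.1 - (p i).1) * d.1 + (v.2 - (p
    i).2) * d.2)) → (∃ d : ℤ × ℤ, (d = (1, 0) ∨ d = (-1, 0) ∨ d = (0, 1) ∨ d = (0, -1)) ∧ ∀ v : ℤ × ℤ, (((((v).1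
    - (q).1) ^ 2 + ((v).2 - (q).2) ^ 2 : ℤ) : ℝ)) ≤ (ρ / 4 / δ n) ^ 2 → (v ∈ V n ↔ 0 ≤ (v.1 - (q).1) * d.1 +
    (v.2 - (q).2) * d.2)) → (∀ i₁ i₂ : Fin k, i₁ ≠ i₂ → (r / δ n) ^ 2 ≤ ((((((p) i₁).1 - ((p) i₂).1) ^ 2 + (((p)
    i₁).2 - ((p) i₂).2) ^ 2 : ℤ) : ℝ))) → (∀ i₁ i₂ : Fin k, i₁ ≠ i₂ → (r / δ n) ^ 2 ≤ (((((((Function.update p i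
    q)) i₁).1 - (((Function.update p i q)) i₂).1) ^ 2 + ((((Function.update p i q)) i₁).2 - (((Function.update p
    i q)) i₂).2) ^ 2 : ℤ) : ℝ))) → (((((q).1 - (p i).1) ^ 2 + ((q).2 - (p i).2) ^ 2 : ℤ) : ℝ)) ≤ (ρ / δ n) ^ 2 →
    |(Real.log (‖Literature.Probability.LatticeModels.CollarLegModel.Zins (V n) (⟨(Finset.univ.erase j).image
    ((Function.update p i q)), fun v ↦ ∑ b ∈ (Finset.univ.erase j).filter (fun b ↦ ((Function.update p i q)) b =
    v), L b, ((Function.update p i q)) j⟩ :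
    Literature.Probability.LatticeModels.CollarLegModel.LegInsertionData)‖ /
    ‖(Literature.Probability.LatticeModels.CollarLegModel.ofDomain (V n)).Z‖) - (∑ i₁ : Fin k, ∑ i₂ ∈
    Finset.univ.filter (fun i₂ : Fin k ↦ i₁ < i₂), (-((if i₁ = j then (1 - (L j : ℝ)) else (L i₁ : ℝ)) * (if i₂
    = j then (1 - (L j : ℝ)) else (L i₂ : ℝ))) / 6) * Real.log
    (Literature.Probability.LatticeModels.dirichletGreen ((V n).image (fun v : ℤ × ℤ ↦ (![v.1, v.2] : Fin 2 →
    ℤ))) (![(((Function.update p i q)) i₁).1, (((Function.update p i q)) i₁).2] : Fin 2 → ℤ)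
    (![(((Function.update p i q)) i₂).1, (((Function.update p i q)) i₂).2] : Fin 2 → ℤ)))) - (Real.log
    (‖Literature.Probability.LatticeModels.CollarLegModel.Zins (V n) (⟨(Finset.univ.erase j).image (p), fun v ↦
    ∑ b ∈ (Finset.univ.erase j).filter (fun b ↦ (p) b = v), L b, (p) j⟩ :
    Literature.Probability.LatticeModels.CollarLegModel.LegInsertionData)‖ /
    ‖(Literature.Probability.LatticeModels.CollarLegModel.ofDomain (V n)).Z‖) - (∑ i₁ : Fin k, ∑ i₂ ∈
    Finset.univ.filter (fun i₂ : Fin k ↦ i₁ < i₂), (-((if i₁ = j then (1 - (L j : ℝ)) else (L i₁ : ℝ)) * (if i₂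
    = j then (1 - (L j : ℝ)) else (L i₂ : ℝ))) / 6) * Real.log
    (Literature.Probability.LatticeModels.dirichletGreen ((V n).image (fun v : ℤ × ℤ ↦ (![v.1, v.2] : Fin 2 →
    ℤ))) (![((p) i₁).1, ((p) i₁).2] : Fin 2 → ℤ) (![((p) i₂).1, ((p) i₂).2] : Fin 2 → ℤ))))| ≤ ε) := by
  sorry

/-! ### Stub 2″ — RAINBOW LOCALITY (v7): the percolation half P1 of cluster locality; CLV3 is derived -/

/-- **Stub 2″ — rainbow locality (RL; skeleton v7).** For a leg family `(L, sink j)` and `ε > 0` there is `M` such that for chart-regular `V, V'`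
(lattice-connected, boundary charts of radius 3, king charts of radius 6) with king-connected complements, agreeing with upper half-planes on the
balls of radius `M·m` about anchors `a, a'`, and every injective admissible configuration `p` within `m` of `a` (translate `p' = p − a + a'`) with
positive rainbow functionals, `|log(‖Zins_V(p)‖/‖Z_V‖) − log(‖Zins_V'(p')‖/‖Z_V'‖)| ≤ ε`, uniformly in `m ≥ 1`. Through the landed dictionary
(`s17_dictionary`: `‖Zins‖ = #Rainbow`, `‖Z‖ = 2^{|E|}`) this is the locality of the rainbow COUNT RATIO — percolation locality P1 for general leg
families (half-plane multi-arm separation / quasi-multiplicativity; Kesten 1987, Nolin 2008 technology). The (2;2) member is PROVED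
(`s18_rainbowLocality_22`, p132784). Size XL (research-level for general families). [folklore] -/
theorem stub_rainbowLocality : ∀ (k : ℕ) (L : Fin k → ℕ) (j : Fin k), L j = ∑ i ∈ Finset.univ.erase j, L i → ∀ ε : ℝ, 0 < ε → ∃ M : ℝ, 0 < M ∧ ∀ (V V' : Finset (ℤ × ℤ)) (a a' : ℤ × ℤ) (m : ℝ), 1 ≤ m → Literature.Probability.LatticeModels.CollarLegModel.ChartRegular V → (∀ u ∉ V, ∀ w ∉ V, Relation.ReflTransGen (fun b c : ℤ × ℤ ↦ b ∉ V ∧ c ∉ V ∧ max |b.1 - c.1| |b.2 - c.2| ≤ 1) u w) → Literature.Probability.LatticeModels.CollarLegModel.ChartRegular V' → (∀ u ∉ V', ∀ w ∉ V', Relation.ReflTransGen (fun b c : ℤ × ℤ ↦ b ∉ V' ∧ c ∉ V' ∧ max |b.1 - c.1| |b.2 - c.2| ≤ 1) u w) → (∀ v : ℤ × ℤ, ((((v.1 - a.1) ^ 2 + (v.2 - a.2) ^ 2 : ℤ) : ℝ)) ≤ (M * m) ^ 2 → (v ∈ V ↔ 0 ≤ v.2 - a.2)) → (∀ v : ℤ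 × ℤ, ((((v.1 - a'.1) ^ 2 + (v.2 - a'.2) ^ 2 : ℤ) : ℝ)) ≤ (M * m) ^ 2 → (v ∈ V' ↔ 0 ≤ v.2 - a'.2)) → ∀ (p : Fin k → ℤ × ℤ), Function.Injective p → (∀ i, (((((p i).1 - a.1) ^ 2 + ((p i).2 - a.2) ^ 2 : ℤ) : ℝ)) ≤ m ^ 2) → Literature.Probability.LatticeModels.CollarLegModel.LegInsertionData.IsAdmissible (⟨(Finset.univ.erase j).image p, fun v ↦ ∑ b ∈ (Finset.univ.erase j).filter (fun b ↦ p b = v), L b, p j⟩ : Literature.Probability.LatticeModels.CollarLegModel.LegInsertionData) V → Literature.Probability.LatticeModels.CollarLegModel.LegInsertionData.IsAdmissible (⟨(Finset.univ.erase j).image (fun i ↦ p i - a + a'), fun v ↦ ∑ b ∈ (Finset.univ.erase j).filter (fun b ↦ (fun i ↦ p i - a + a') b = v), L b, (fun i ↦ p i - a + a') j⟩ : Literature.Probability.LatticeModels.CollarLegModel.LegInsertionData) V' → 0 < (‖Literature.Probability.LatticeModels.CollarLegModel.Zins V (⟨(Finset.univ.erase j).image p, fun v ↦ ∑ b ∈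 (Finset.univ.erase j).filter (fun b ↦ p b = v), L b, p j⟩ : Literature.Probability.LatticeModels.CollarLegModel.LegInsertionData)‖ / ‖(Literature.Probability.LatticeModels.CollarLegModel.ofDomain V).Z‖) → 0 < (‖Literature.Probability.LatticeModels.CollarLegModel.Zins V' (⟨(Finset.univ.erase j).image (fun i ↦ p i - a + a'), fun v ↦ ∑ b ∈ (Finset.univ.erase j).filter (fun b ↦ (fun i ↦ p i - a + a') b = v), L b, (fun i ↦ p i - a + a') j⟩ : Literature.Probability.LatticeModels.CollarLegModel.LegInsertionData)‖ / ‖(Literature.Probability.LatticeModels.CollarLegModel.ofDomain V').Z‖) → |Real.log (‖Literature.Probability.LatticeModels.CollarLegModel.Zins V (⟨(Finset.univ.erase j).image p, fun v ↦ ∑ b ∈ (Finset.univ.erase j).filter (fun b ↦ p b = v), L b, p j⟩ : Literature.Probability.LatticeModels.CollarLegModel.LegInsertionData)‖ / ‖(Literature.Probability.LatticeModels.CollarLegModel.ofDomain V).Z‖) - Real.log (‖Literature.Probability.LatticeModels.CollarLegModel.Zins V' (⟨(Finset.univ.erase j).image (fun i ↦ p i - a + a'), fun v ↦ ∑ b ∈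 (Finset.univ.erase j).filter (fun b ↦ (fun i ↦ p i - a + a') b = v), L b, (fun i ↦ p i - a + a') j⟩ : Literature.Probability.LatticeModels.CollarLegModel.LegInsertionData)‖ / ‖(Literature.Probability.LatticeModels.CollarLegModel.ofDomain V').Z‖)| ≤ ε := by
  sorry

/-- **Stub 2′ (cluster locality) is now DERIVED (v7)** in its chart-regular typing CLV3: rainbow locality (Stub 2″) plus the landed Green
locality G1 (`s10_greenLocalityZ2`), glued by `clusterLocalityV3_of_rainbowLocality` (…StubClusterLocalityV3Glue, p131700). [folklore] -/
theorem stub_clusterLocalityV3 : ∀ (k : ℕ) (L : Fin k → ℕ) (j : Fin k), L j = ∑ i ∈ Finset.univ.erase j, L i → ∀ ε : ℝ, 0 < ε → ∃ M : ℝ, 0 < M ∧ ∀ (V V' : Finset (ℤ × ℤ)) (a a' : ℤ × ℤ) (m : ℝ), 1 ≤ m → Literature.Probability.LatticeModels.CollarLegModel.ChartRegular V → (∀ u ∉ V, ∀ w ∉ V, Relation.ReflTransGen (fun b c : ℤ × ℤ ↦ b ∉ V ∧ c ∉ V ∧ max |b.1 - c.1| |b.2 - c.2| ≤ 1) u w)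 → Literature.Probability.LatticeModels.CollarLegModel.ChartRegular V' → (∀ u ∉ V', ∀ w ∉ V', Relation.ReflTransGen (fun b c : ℤ × ℤ ↦ b ∉ V' ∧ c ∉ V' ∧ max |b.1 - c.1| |b.2 - c.2| ≤ 1) u w) → (∀ v : ℤ × ℤ, ((((v.1 - a.1) ^ 2 + (v.2 - a.2) ^ 2 : ℤ) : ℝ)) ≤ (M * m) ^ 2 → (v ∈ V ↔ 0 ≤ v.2 - a.2)) → (∀ v : ℤ × ℤ, ((((v.1 - a'.1) ^ 2 + (v.2 - a'.2) ^ 2 : ℤ) : ℝ)) ≤ (M * m) ^ 2 → (v ∈ V' ↔ 0 ≤ v.2 - a'.2)) → ∀ (p : Fin k → ℤ × ℤ), Function.Injective p → (∀ i, (((((p i).1 - a.1) ^ 2 + ((p i).2 - a.2) ^ 2 : ℤ) : ℝ)) ≤ m ^ 2) → Literature.Probability.LatticeModels.CollarLegModel.LegInsertionData.IsAdmissible (⟨(Finset.univ.erase j).image p, fun v ↦ ∑ b ∈ (Finset.univ.erase j).filter (fun b ↦ p b = v), L b, p j⟩ : Literature.Probability.LatticeModels.CollarLegModel.LegInsertionData)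 V → Literature.Probability.LatticeModels.CollarLegModel.LegInsertionData.IsAdmissible (⟨(Finset.univ.erase j).image (fun i ↦ p i - a + a'), fun v ↦ ∑ b ∈ (Finset.univ.erase j).filter (fun b ↦ (fun i ↦ p i - a + a') b = v), L b, (fun i ↦ p i - a + a') j⟩ : Literature.Probability.LatticeModels.CollarLegModel.LegInsertionData) V' → 0 < (‖Literature.Probability.LatticeModels.CollarLegModel.Zins V (⟨(Finset.univ.erase j).image p, fun v ↦ ∑ b ∈ (Finset.univ.erase j).filter (fun b ↦ p b = v), L b, p j⟩ : Literature.Probability.LatticeModels.CollarLegModel.LegInsertionData)‖ / ‖(Literature.Probability.LatticeModels.CollarLegModel.ofDomain V).Z‖) → 0 < (‖Literature.Probability.LatticeModels.CollarLegModel.Zins V' (⟨(Finset.univ.erase j).image (fun i ↦ p i - a + a'), fun v ↦ ∑ b ∈ (Finset.univ.erase j).filter (fun b ↦ (fun i ↦ p i - a + a') b = v), L b, (fun i ↦ p i - a + a') j⟩ : Literature.Probability.LatticeModels.CollarLegModel.LegInsertionData)‖ / ‖(Literature.Probability.LatticeModels.CollarLegModel.ofDomain V').Z‖) → |(Real.log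 (‖Literature.Probability.LatticeModels.CollarLegModel.Zins V (⟨(Finset.univ.erase j).image p, fun v ↦ ∑ b ∈ (Finset.univ.erase j).filter (fun b ↦ p b = v), L b, p j⟩ : Literature.Probability.LatticeModels.CollarLegModel.LegInsertionData)‖ / ‖(Literature.Probability.LatticeModels.CollarLegModel.ofDomain V).Z‖) - (∑ i₁ : Fin k, ∑ i₂ ∈ Finset.univ.filter (fun i₂ : Fin k ↦ i₁ < i₂), (-((if i₁ = j then (1 - (L j : ℝ)) else (L i₁ : ℝ)) * (if i₂ = j then (1 - (L j : ℝ)) else (L i₂ : ℝ))) / 6) * Real.log (Literature.Probability.LatticeModels.dirichletGreen (V.image (fun v : ℤ × ℤ ↦ (![v.1, v.2] : Fin 2 → ℤ))) (![(p i₁).1, (p i₁).2] : Fin 2 → ℤ) (![(p i₂).1, (p i₂).2] : Fin 2 → ℤ)))) - (Real.log (‖Literature.Probability.LatticeModels.CollarLegModel.Zins V' (⟨(Finset.univ.erase j).image (fun i ↦ p i - a + a'), fun v ↦ ∑ b ∈ (Finset.univ.erase j).filter (fun b ↦ (fun i ↦ p i - a + a') b = v), L b, (fun i ↦ p i - a +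 a') j⟩ : Literature.Probability.LatticeModels.CollarLegModel.LegInsertionData)‖ / ‖(Literature.Probability.LatticeModels.CollarLegModel.ofDomain V').Z‖) - (∑ i₁ : Fin k, ∑ i₂ ∈ Finset.univ.filter (fun i₂ : Fin k ↦ i₁ < i₂), (-((if i₁ = j then (1 - (L j : ℝ)) else (L i₁ : ℝ)) * (if i₂ = j then (1 - (L j : ℝ)) else (L i₂ : ℝ))) / 6) * Real.log (Literature.Probability.LatticeModels.dirichletGreen (V'.image (fun v : ℤ × ℤ ↦ (![v.1, v.2] : Fin 2 → ℤ))) (![((fun i ↦ p i - a + a') i₁).1, ((fun i ↦ p i - a + a') i₁).2] : Fin 2 → ℤ) (![((fun i ↦ p i - a + a') i₂).1, ((fun i ↦ p i - a + a') i₂).2] : Fin 2 → ℤ))))| ≤ ε :=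
  clusterLocalityV3_of_rainbowLocality stub_rainbowLocality

/-! ### Stubs 3a/3b — TRANSPORT PATHS and HOLE-FREENESS: LANDED (`stub_transportPaths`, `stub_holeFree`, imported) -/

/-! ### Stub 3c — REALISABILITY: `stub_rainbowNonempty` and `stub_dictionaryPositivity` are LANDED (v6, imported); REAL is derived -/

/-- **Stub 3c (REAL) is a THEOREM (v6)**: derived from the landed `stub_rainbowNonempty` (3c₁) and `stub_dictionaryPositivity` (3c₂), both eventually-statements on the same filter. [folklore] -/
theorem stub_realisability : ∀ (k : ℕ) (L : Fin k → ℕ) (j : Fin k), L j = ∑ i ∈ Finset.univ.erase j, L i → ∀ (D : Literature.Probability.RandomPlanarGeometry.JordanDomain), (∃ S : Finset (ℂ × ℂ), (∀ q ∈ S, q.1.re = q.2.re ∨ q.1.im = q.2.im) ∧ frontier D.carrier ⊆ ⋃ q ∈ S, segment ℝ q.1 q.2) → ∀ (r : ℝ), 0 < r → ∀ (δ : ℕ → ℝ), (∀ n, 0 < δ n) → Filter.Tendsto δ Filter.atTop (nhds 0) → ∀ (V : ℕ → Finset (ℤ × ℤ)), (∀ n, ∀ v : ℤ × ℤ, v ∈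 V n ↔ (((v).1 : ℂ) * ((δ n : ℝ) : ℂ) + ((v).2 : ℂ) * ((δ n : ℝ) : ℂ) * Complex.I) ∈ closure D.carrier) → ∀ᶠ n in Filter.atTop, ∀ (p : Fin k → ℤ × ℤ), Function.Injective p → Literature.Probability.LatticeModels.CollarLegModel.LegInsertionData.IsAdmissible (⟨(Finset.univ.erase j).image (p), fun v ↦ ∑ b ∈ (Finset.univ.erase j).filter (fun b ↦ (p) b = v), L b, (p) j⟩ : Literature.Probability.LatticeModels.CollarLegModel.LegInsertionData) (V n) → (∀ i', (∃ d : ℤ × ℤ, (d = (1, 0) ∨ d = (-1, 0) ∨ d = (0, 1) ∨ d = (0, -1)) ∧ ∀ v : ℤ × ℤ, (((((v).1 - (p i').1) ^ 2 + ((v).2 - (p i').2) ^ 2 : ℤ) : ℝ)) ≤ (r / δ n) ^ 2 → (v ∈ V n ↔ 0 ≤ (v.1 - (p i').1) * d.1 + (v.2 - (p i').2) * d.2))) → (∀ i₁ i₂ : Fin k, i₁ ≠ i₂ → (r / δ n) ^ 2 ≤ ((((((p) i₁).1 - ((p) i₂).1) ^ 2 + (((p) i₁).2 - ((p) i₂).2)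 ^ 2 : ℤ) : ℝ))) → 0 < (‖Literature.Probability.LatticeModels.CollarLegModel.Zins (V n) (⟨(Finset.univ.erase j).image (p), fun v ↦ ∑ b ∈ (Finset.univ.erase j).filter (fun b ↦ (p) b = v), L b, (p) j⟩ : Literature.Probability.LatticeModels.CollarLegModel.LegInsertionData)‖ / ‖(Literature.Probability.LatticeModels.CollarLegModel.ofDomain (V n)).Z‖) :=
  fun k L j hL D hD r hr δ hδ hδ0 V hV =>
    ((stub_rainbowNonempty k L j hL D hD r hr δ hδ hδ0 V hV).and
      (stub_dictionaryPositivity k L j hL D hD r hr δ hδ hδ0 V hV)).mono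
      fun _ hn p hp hadm hflat hsep => hn.2 p hp hadm hflat hsep (hn.1 p hp hadm hflat hsep)

/-! ### Stub 4″ — the CANONICAL LIMIT (v5 reshape of Stub 4′ REFV2) -/

/-- **Stub 4″ — canonical limit (CANON; skeleton v5).** The open content of the reference limit, reduced to ONE
explicit family of numerical sequences per leg family `(k, L, j)`: on the lattice boxes `V_n = [-⌊1/δ_n⌋₊, ⌊1/δ_n⌋₊]²`
(the lattice approximations of the reference square `(-1,1)²`) with the CANONICAL bottom-row configuration
`p_n i = (⌊x_i/δ_n⌋, -⌊1/δ_n⌋₊)`, `x_i = 2(i+1)/(k+1) - 1`, the Green-normalised rainbow functional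
`F_n = log(‖Zins‖/‖Z‖) - Σ_{i<i'} (-e_i e_i'/6) log G_{V_n}(p_n i, p_n i')` converges along every mesh sequence
`δ_n → 0⁺` (to a limit `ℓ` independent of the sequence). This IS the sharp Coulomb-gas normalisation for one
configuration — open on ℤ² (crux-sized: for (2;2) it gives the boundary two-point exponent 2/3 of critical bond
percolation on ℤ²; nearest theorem shape on 𝕋: Du–Gao–Li–Zhuang 2024); typed by worker 3 (1561 chars, registered
as `stub_canonicalLimit`); everything else of Stub 4′ is LANDED (`s12_canonicalConfiguration` p117657,
`refV2_of_canonicalLimit` p118202). Size XL (open). [folklore] -/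
theorem stub_canonicalLimit : ∀ (k : ℕ) (L : Fin k → ℕ) (j : Fin k), L j = ∑ i ∈ Finset.univ.erase j, L i → (∃ i, i ≠ j) → (∀ i, i ≠ j → 1 ≤ L i) → ∃ ℓ : ℝ, ∀ (δ : ℕ → ℝ), (∀ n, 0 < δ n) → Filter.Tendsto δ Filter.atTop (nhds 0) → ∀ (V : ℕ → Finset (ℤ × ℤ)), (∀ n, ∀ v : ℤ × ℤ, v ∈ V n ↔ (-(⌊1 / δ n⌋₊ : ℤ) ≤ v.1 ∧ v.1 ≤ ⌊1 / δ n⌋₊) ∧ (-(⌊1 / δ n⌋₊ : ℤ) ≤ v.2 ∧ v.2 ≤ ⌊1 / δ n⌋₊)) → ∀ (p : ℕ → Fin k → ℤ × ℤ), (∀ n i, p n i = (⌊(2 * ((i : ℝ) + 1) / (k + 1) - 1) / δ n⌋, -(⌊1 / δ n⌋₊ : ℤ))) → (∀ n, Function.Injective (p n)) → (∀ n, Literature.Probability.LatticeModels.CollarLegModel.LegInsertionData.IsAdmissible (⟨(Finset.univ.erase j).image (p n), fun v ↦ ∑ b ∈ (Finset.univ.erase j).filter (fun b ↦ (p n) b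 = v), L b, (p n) j⟩ : Literature.Probability.LatticeModels.CollarLegModel.LegInsertionData) (V n)) → Filter.Tendsto (fun n ↦ (Real.log (‖Literature.Probability.LatticeModels.CollarLegModel.Zins (V n) (⟨(Finset.univ.erase j).image (p n), fun v ↦ ∑ b ∈ (Finset.univ.erase j).filter (fun b ↦ (p n) b = v), L b, (p n) j⟩ : Literature.Probability.LatticeModels.CollarLegModel.LegInsertionData)‖ / ‖(Literature.Probability.LatticeModels.CollarLegModel.ofDomain (V n)).Z‖) - (∑ i₁ : Fin k, ∑ i₂ ∈ Finset.univ.filter (fun i₂ : Fin k ↦ i₁ < i₂), (-((if i₁ = j then (1 - (L j : ℝ)) else (L i₁ : ℝ)) * (if i₂ = j then (1 - (L j : ℝ)) else (L i₂ : ℝ))) / 6) * Real.log (Literature.Probability.LatticeModels.dirichletGreen ((V n).image (fun v : ℤ × ℤ ↦ (![v.1, v.2] : Fin 2 → ℤ))) (![((p n) i₁).1, ((p n) i₁).2] : Fin 2 → ℤ) (![((p n) i₂).1, ((p n) i₂).2] : Fin 2 → ℤ))))) Filter.atTop (nhds ℓ) := by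
  sorry

/-- **Stub 4′ (REFV2) is now DERIVED**: RIGIDITY (from transport paths, eventual chart-regularity, realisability, point transport and
cluster locality CLV3 — `s3_rigidityOfTransportV3`, landed) transfers the canonical limit of Stub 4″ to every admissible
injective configuration converging to the marks of the explicit reference square (`refV2_of_canonicalLimit`, landed
…StubReferenceLimitPart7, p118202). No `sorry` here beyond the stubs it consumes. [folklore] -/
theorem stub_referenceLimitV2 : ∀ (k : ℕ) (L : Fin k → ℕ) (j : Fin k), L j = ∑ i ∈ Finset.univ.erase j, L i → (∃ i, i ≠ j) → (∀ i, i ≠ j → 1 ≤ L i) → ∃ D₀ : Literature.Probability.RandomPlanarGeometry.MarkedDomain k, (∃ S : Finset (ℂ × ℂ), (∀ q ∈ S, q.1.re = q.2.re ∨ q.1.im = q.2.im) ∧ frontier D₀.carrier ⊆ ⋃ q ∈ S, segment ℝ q.1 q.2) ∧ (∀ i, (∃ r : ℝ, 0 < r ∧ ((∀ z ∈ frontier D₀.carrier, dist z (D₀.pt i) < r → z.im = (D₀.pt i).im) ∨ (∀ z ∈ frontier D₀.carrier, dist z (D₀.pt i) < r → z.re = (D₀.pt i).re)))) ∧ (∃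 τ : ℂ, ‖τ‖ = 1 ∧ (∃ ε : ℝ, 0 < ε ∧ ∀ t ∈ Set.Ioo (D₀.mark j) (D₀.mark j + ε), ∃ s : ℝ, 0 < s ∧ D₀.boundary t = D₀.pt j + (s : ℂ) * τ) ∧ (∃ ε : ℝ, 0 < ε ∧ ∀ s ∈ Set.Ioo (0 : ℝ) ε, D₀.pt j + (s : ℂ) * (τ * Complex.I) ∈ D₀.carrier)) ∧ (∀ (δ : ℕ → ℝ), (∀ n, 0 < δ n) → Filter.Tendsto δ Filter.atTop (nhds 0) → ∀ (V : ℕ → Finset (ℤ × ℤ)), (∀ n, ∀ v : ℤ × ℤ, v ∈ V n ↔ (((v).1 : ℂ) * ((δ n : ℝ) : ℂ) + ((v).2 : ℂ) * ((δ n : ℝ) : ℂ) * Complex.I) ∈ closure D₀.carrier) → ∃ p : ℕ → Fin k → ℤ × ℤ, (∀ n, Function.Injective ((p) n)) ∧ (∀ i, Filter.Tendsto (fun n ↦ ((((p) n i).1 : ℂ) * ((δ n : ℝ) : ℂ) + (((p) n i).2 : ℂ) * ((δ n : ℝ) : ℂ) * Complex.I)) Filter.atTop (nhds (D₀.pt i)))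 ∧ ∃ N : ℕ, ∀ n, N ≤ n → Literature.Probability.LatticeModels.CollarLegModel.LegInsertionData.IsAdmissible (⟨(Finset.univ.erase j).image (p n), fun v ↦ ∑ b ∈ (Finset.univ.erase j).filter (fun b ↦ (p n) b = v), L b, (p n) j⟩ : Literature.Probability.LatticeModels.CollarLegModel.LegInsertionData) (V n)) ∧ ∃ ℓ : ℝ, ∀ (δ : ℕ → ℝ), (∀ n, 0 < δ n) → Filter.Tendsto δ Filter.atTop (nhds 0) → ∀ (V : ℕ → Finset (ℤ × ℤ)), (∀ n, ∀ v : ℤ × ℤ, v ∈ V n ↔ (((v).1 : ℂ) * ((δ n : ℝ) : ℂ) + ((v).2 : ℂ) * ((δ n : ℝ) : ℂ) * Complex.I) ∈ closure D₀.carrier) → ∀ (p : ℕ → Fin k → ℤ × ℤ), (∀ n, Function.Injective ((p) n)) → (∀ i, Filter.Tendsto (fun n ↦ ((((p) n i).1 : ℂ) * ((δ n : ℝ) : ℂ) + (((p) n i).2 : ℂ) * ((δ n : ℝ) : ℂ) * Complex.I)) Filter.atTop (nhds (D₀.pt i))) → (∀ n, Literature.Probability.LatticeModels.CollarLegModel.LegInsertionData.IsAdmissible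 (⟨(Finset.univ.erase j).image ((p) n), fun v ↦ ∑ b ∈ (Finset.univ.erase j).filter (fun b ↦ ((p) n) b = v), L b, ((p) n) j⟩ : Literature.Probability.LatticeModels.CollarLegModel.LegInsertionData) (V n)) → Filter.Tendsto (fun n ↦ (Real.log (‖Literature.Probability.LatticeModels.CollarLegModel.Zins (V n) (⟨(Finset.univ.erase j).image (p n), fun v ↦ ∑ b ∈ (Finset.univ.erase j).filter (fun b ↦ (p n) b = v), L b, (p n) j⟩ : Literature.Probability.LatticeModels.CollarLegModel.LegInsertionData)‖ / ‖(Literature.Probability.LatticeModels.CollarLegModel.ofDomain (V n)).Z‖) - (∑ i₁ : Fin k, ∑ i₂ ∈ Finset.univ.filter (fun i₂ : Fin k ↦ i₁ < i₂), (-((if i₁ = j then (1 - (L j : ℝ)) else (L i₁ : ℝ)) * (if i₂ = j then (1 - (L j : ℝ)) else (L i₂ : ℝ))) / 6) * Real.log (Literature.Probability.LatticeModels.dirichletGreen ((V n).image (fun v : ℤ × ℤ ↦ (![v.1, v.2] : Fin 2 → ℤ))) (![((p n) i₁).1, ((p n) i₁).2] : Fin 2 → ℤ) (![((p n) i₂).1,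 ((p n) i₂).2] : Fin 2 → ℤ))))) Filter.atTop (nhds ℓ) :=
  refV2_of_canonicalLimit
    (s3_rigidityOfTransportV3 stub_transportPaths s3_eventuallyRegular stub_realisability stub_pointTransport
      stub_clusterLocalityV3)
    stub_canonicalLimit

/-! ### Stub 5 — GREEN KERNEL ASYMPTOTICS: reduced to two named Literature facts, both now PROVED in the tree -/

/-- **Stub 5a — Kenyon's flat-edge Poisson-kernel limit on ℤ²** (named fact
`Literature.Probability.LatticeModels.Kenyon2000_flatEdgePoissonKernelLimit`, Kenyon 2000 Lemma 17 / Cor. 19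
specialised to lattice approximations of rectilinear Jordan domains; typed and relocated by the round-2 green
worker, p96029). DISCHARGED (v4): `Kenyon2000_flatEdgePoissonKernelLimit_holds`
(`Literature/Probability/LatticeModels/FlatBoundaryPoissonKernelLimitProofs.lean`). [cite: Kenyon2000, Cor. 19] -/
theorem stub_flatEdgePoissonKernelLimit :
    Literature.Probability.LatticeModels.Kenyon2000_flatEdgePoissonKernelLimit :=
  Literature.Probability.LatticeModels.Kenyon2000_flatEdgePoissonKernelLimit_holds

/-- **Stub 5b — Chelkak–Smirnov's boundary-normalised Poisson-kernel limit on ℤ²** (named fact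
`Literature.Probability.LatticeModels.ChelkakSmirnov2011_boundaryNormalisedPoissonKernelLimit`, Chelkak–Smirnov
2011 Thm 3.13 specialised to ℤ² and rectilinear Jordan domains, p96029). DISCHARGED (v4):
`ChelkakSmirnov2011_boundaryNormalisedPoissonKernelLimit_holds`
(`Literature/Probability/LatticeModels/BoundaryNormalisedPoissonKernelLimitProofs.lean`). [cite: ChelkakSmirnov2011, Thm 3.13] -/
theorem stub_boundaryNormalisedPoissonKernelLimit :
    Literature.Probability.LatticeModels.ChelkakSmirnov2011_boundaryNormalisedPoissonKernelLimit :=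
  Literature.Probability.LatticeModels.ChelkakSmirnov2011_boundaryNormalisedPoissonKernelLimit_holds

/- Stub 5 of v1/v2 (`stub_greenKernelAsymptotics`, flat-edge asymptotics of `dirichletGreen` with `c = 1/π`) now
FOLLOWS from the two facts by the landed reduction `greenKernelAsymptotics_of_facts` (…StubGreenKernelAsymptoticsPart5);
the composition below uses it directly. -/

/-! ### The composition: the crux BY NAME (glue landed: `stub_transferV2`, `s3_rigidityOfTransportV2`) -/

/-- **The skeleton closes (v5).** Transport paths (landed), hole-freeness (landed), realisability and the two
local laws give RIGIDITY (`s3_rigidityOfTransportV2`, landed); the corrected reference limit and the Green kernel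
asymptotics (from the two named facts by the landed reduction) feed `stub_transferV2` (landed), which concludes
`Summit.CriticalPhenomena.CardyFormulaZ2.Theses.CardyBoundaryCoulombGas.BoundaryDefectGaussianR` BY NAME.
No `sorry` outside the three open stubs (v7: PT, CANON, RL). [folklore] -/
theorem BoundaryDefectGaussianR_of :
    Summit.CriticalPhenomena.CardyFormulaZ2.Theses.CardyBoundaryCoulombGas.BoundaryDefectGaussianR :=
  stub_transferV2
    (s3_rigidityOfTransportV3 stub_transportPaths s3_eventuallyRegular stub_realisability stub_pointTransport
      stub_clusterLocalityV3)
    stub_referenceLimitV2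
    (greenKernelAsymptotics_of_facts stub_flatEdgePoissonKernelLimit stub_boundaryNormalisedPoissonKernelLimit)

end Summit.CriticalPhenomena.CardyFormulaZ2.Cruxes.BoundaryDefectGaussianR.RainbowMonomialsInExcursionKernels

end
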